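import Mathlib
import HarnessLib
import Summits.NavierStokesRegularity.NavierStokesRegularity.Theses.QuarterTurnRdss
import Literature.Analysis.FluidPDE.SelfSimilar
import Literature.Analysis.FluidPDE.TypeIAncientMild
import Literature.Analysis.FluidPDE.TypeIAncientMildDecay
import Literature.Analysis.FluidPDE.TypeIAncientMildClassical
import Literature.Analysis.FluidPDE.ESSLocalHolderVorticityC12
import Literature.Analysis.FluidPDE.CurlFreeLiouville
import Literature.Analysis.FluidPDE.TaoEnstrophyLocalisation
import Literature.Analysis.FluidPDE.ClassicalSuitableRegion
import Literature.Analysis.FluidPDE.ClassicalSolutionRegion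
import Literature.Analysis.FluidPDE.CarlemanRegularityC12
import Literature.Analysis.FluidPDE.BackwardUniquenessRescale
import Summits.NavierStokesRegularity.NavierStokesRegularity.Theorems.DssFarFieldSlavingBlowupTypeIDssProfileSmoothRepresentativeAe
import Summits.NavierStokesRegularity.NavierStokesRegularity.Theorems.QuarterTurnRdssNoSilentTypeIProfileFarField

/-!
# `QuarterTurnRdss.NoSilentTypeIProfile` — every Type-I ancient mild solution leaves debris
  (item stmt-NavierStokesRegularity-1104, route `QuarterTurnRdss`, support; part II, closes the item;
  part I = `QuarterTurnRdssNoSilentTypeIProfileFarField.lean`)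

HONEST FRAMING: a Liouville-type lemma about HYPOTHETICAL objects (Type-I ancient mild solutions of
the Navier–Stokes equations, the would-be blow-up profiles); nothing here bears on the regularity
problem itself.

**Statement** (`Summit.NavierStokesRegularity.NavierStokesRegularity.Theses.QuarterTurnRdss.NoSilentTypeIProfile`).
An ancient mild solution `u` (`ν = 1`, duality form, measurable slices) on `ℝ³ × (−∞, 0)` with the
Type-I bound `‖u(t,x)‖ ≤ C₀/(‖x‖ + √(−t))` whose final datum vanishes outside some ball — rendered as
`∫_{ρ<‖x‖<r} ‖u(t,x)‖ dx → 0` as `t → 0⁻` for every `r > ρ` — is trivial: `u(t) = 0` a.e. for every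
`t < 0`.

**Proof** (Escauriaza–Seregin–Šverák 2003, §3 and Thms. 4.1, 5.1, in the tree's class `C¹₂`
Carleman vocabulary; every analytic input is a tree theorem).
1. KNSS gauge: `typeI_ancient_smoothRepresentative_ae` replaces `u` by a jointly smooth Oseen-mild
   representative `V` (`IsTypeIAncientMild C₀ V`, `HasTypeIDecay C₀ V`, `V t = u t` a.e.).
2. Exterior bounds up to the top time: Chae–Wolf's gauge bounds
   `(‖x‖ + √(−t))^{k+1}‖DᵏV(t,x)‖ ≤ C_k`, `k ≤ 3` (`IsTypeIAncientMild.gaugeBounds_of_hasTypeIDecay`),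
   give `‖DᵏV‖ ≤ K` on `(−1,0) × {‖x‖ > ρ}`; a classical pressure exists
   (`IsTypeIAncientMild.exists_isClassicalNSSolutionOn_Ioo`), so `(V, p)` is a distributional solution
   on that region.
3. Far field (ESS Thm. 5.1): the tree's engine `RellichScarApexLocalisation.stub_halfspaceFarFieldCurl`
   applied to `S = {‖x‖ > ρ}`, `x₀ = ρe`, and the truncated field `w = 𝟙_S V` — whose weak vanishing
   at the top is exactly the item's annulus hypothesis — gives `curl V = 0` on `(−1,0) × {‖x‖ > ρ}`.
4. Inward (ESS Thm. 4.1): unique continuation across spheres at every `t ∈ (−1,0)`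
   (`vorticity_carleman_inequality` on the strip `(−1, t/2)`, `Carleman.uniqueContinuation_uncurried_c12`),
   verbatim after `RellichScarNoMildScar.apex_strip_velocity_ae_zero`: `curl V(t,·) ≡ 0`.
5. `curl V(t) = 0`, `div V(t) = 0`, `V(t)` bounded ⇒ `V(t)` constant
   (`eq_of_curl_eq_zero_of_isDivFree_of_bounded`) ⇒ `V(t) = 0` by the Type-I decay.
6. All `t < 0`: induction over past time-translates `t ↦ t − δ` (`IsTypeIAncientMild.comp_sub_right`),
   for which the annulus hypothesis holds trivially once `V` vanishes on the previous window.

References: L. Escauriaza, G. Seregin, V. Šverák, Russ. Math. Surveys 58 (2003) 211–250, §3,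
Thms. 4.1, 5.1 [EscauriazaSereginSverak2003]; G. Koch, N. Nadirashvili, G. Seregin, V. Šverák,
Acta Math. 203 (2009) 83–105, §4 [KochNadirashviliSereginSverak2009]; D. Chae, J. Wolf,
arXiv:1610.09464, (3.6) [ChaeWolf2017RemovingDSS].
-/

noncomputable section

-- the summit and its single sub-problem share the name (CONVENTIONS §1), as in every Theorems file
set_option linter.dupNamespace false

namespace Summit.NavierStokesRegularity.NavierStokesRegularity.Theorems.NoSilentTypeIProfile

open MeasureTheory Set Function Metric Filter Topology TopologicalSpace
open scoped ENNReal NNReal InnerProductSpace RealInnerProductSpace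
open Literature.Analysis Literature.Analysis.FluidPDE

/-! ### Step B: unique continuation across spheres, slice by slice -/

/-- **The vorticity vanishes everywhere on `(-1, 0)`** once it vanishes in the far field
`{‖x‖ > ρ}` (Escauriaza–Seregin–Šverák 2003, §3 after (3.32), Thm. 4.1: unique continuation across
spatial boundaries, the tree's `Carleman.uniqueContinuation_uncurried_c12`). At a time `t ∈ (-1, 0)`
the field is classical with bounded velocity and gradient on the strip `(-1, t/2) × ℝ³` (Type I), its
vorticity is of class `C¹₂` with the differential inequality `|∂ₜω - Δω| ≤ c(|ω| + |∇ω|)`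
(`vorticity_carleman_inequality`), and the time-reversed translate `ω(t - s, x₁ + y)` about a far
point `x₁` vanishes to infinite order at `(0, 0)` (it is zero near it), hence `ω(t, ·) ≡ 0` on every
ball about `x₁`. The argument is the tree's `RellichScarNoMildScar.apex_strip_velocity_ae_zero`,
verbatim in this class. [cite: EscauriazaSereginSverak2003, §3 after (3.32) and Thm. 4.1] -/
theorem curl_eq_zero_of_farField {V : ℝ → EuclideanSpace ℝ (Fin 3) → EuclideanSpace ℝ (Fin 3)}
    {C₀ ρ : ℝ} (hV : IsTypeIAncientMild C₀ V) (hdec : HasTypeIDecay C₀ V) (hρ : 0 < ρ)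
    (hfar : ∀ z ∈ Ioo (-1 : ℝ) 0 ×ˢ {x : EuclideanSpace ℝ (Fin 3) | ρ < ‖x‖}, curl (V z.1) z.2 = 0)
    {t : ℝ} (ht : t ∈ Ioo (-1 : ℝ) 0) (x : EuclideanSpace ℝ (Fin 3)) : curl (V t) x = 0 := by
  obtain ⟨ht1, ht0⟩ := ht
  -- ### the strip `I = (-1, t/2)` and the equations there
  set I : Set ℝ := Ioo (-1 : ℝ) (t / 2) with hIdef
  have hIo : IsOpen I := isOpen_Ioo
  have htI : t ∈ I := ⟨ht1, by linarith⟩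
  have hIsub : I ⊆ Ioo (-1 : ℝ) 0 := Ioo_subset_Ioo le_rfl (by linarith)
  set Ω : Set (ℝ × EuclideanSpace ℝ (Fin 3)) := I ×ˢ (univ : Set (EuclideanSpace ℝ (Fin 3))) with hΩdef
  have hΩo : IsOpen Ω := hIo.prod isOpen_univ
  obtain ⟨p, hp⟩ := hV.exists_isClassicalNSSolutionOn_Ioo (t₀ := -1) (by norm_num)
  have hsol : IsDistributionalNSSolutionOn ⟨I ×ˢ (univ : Set (EuclideanSpace ℝ (Fin 3))), hIo.prod isOpen_univ⟩ 1 0 V p :=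
    hp.onRegion.isDistributionalNSSolutionOn (isOpen_Ioo.prod isOpen_univ)
      (prod_mono hIsub Subset.rfl)
  have hU4 : ∀ s ∈ I, ContDiffOn ℝ 4 (V s) (univ : Set (EuclideanSpace ℝ (Fin 3))) := fun s hs =>
    ((hV.contDiff_slice (hIsub hs).2).of_le (by norm_cast)).contDiffOn
  have hsm : IsSmoothSpaceTimeOn (Iio 0) V := hV.contDiffOn
  have hΦ : ∀ n ≤ 4, ContinuousOn
      (fun z : ℝ × EuclideanSpace ℝ (Fin 3) => iteratedFDeriv ℝ n (V z.1) z.2) Ω :=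
    fun n _ => ((hsm.iteratedFDeriv_slice isOpen_Iio.uniqueDiffOn n).continuousOn).mono
      (prod_mono (hIsub.trans Ioo_subset_Iio_self) Subset.rfl)
  -- ### Type I bounds on the strip: `|V| ≤ K₀`, `|DV| ≤ K₁`
  obtain ⟨C₁, C₂, C₃, h1, -, -⟩ := IsTypeIAncientMild.gaugeBounds_of_hasTypeIDecay hV hdec
  have hC₀ : 0 ≤ C₀ := hV.nonneg
  have ht2 : 0 < -(t / 2) := by linarith
  have hsq : 0 < Real.sqrt (-(t / 2)) := Real.sqrt_pos.2 ht2
  set K₀ : ℝ := C₀ / Real.sqrt (-(t / 2)) with hK₀def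
  set K₁ : ℝ := C₁ / (-(t / 2)) with hK₁def
  have hK₀ : ∀ z ∈ Ω, ‖V z.1 z.2‖ ≤ K₀ := by
    rintro ⟨s, y⟩ ⟨hs, -⟩
    have hs0 : s < 0 := (hIsub hs).2
    calc ‖V s y‖ ≤ C₀ / Real.sqrt (-s) := hV.norm_le hs0 y
      _ ≤ K₀ := div_le_div_of_nonneg_left hC₀ hsq (Real.sqrt_le_sqrt (by linarith [hs.2]))
  have hK₁ : ∀ z ∈ Ω, ‖fderiv ℝ (V z.1) z.2‖ ≤ K₁ := by
    rintro ⟨s, y⟩ ⟨hs, -⟩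
    have hs0 : s < 0 := (hIsub hs).2
    have hss : 0 < Real.sqrt (-s) := Real.sqrt_pos.2 (by linarith)
    have hb := h1 s hs0 y
    rw [norm_iteratedFDeriv_one] at hb
    have hle : Real.sqrt (-(t / 2)) ≤ ‖y‖ + Real.sqrt (-s) := by
      have := Real.sqrt_le_sqrt (show -(t / 2) ≤ -s by linarith [hs.2])
      linarith [norm_nonneg y]
    have h := le_div_pow_of_pow_mul_le hsq hle (norm_nonneg _) hb
    rwa [Real.sq_sqrt ht2.le] at h
  -- ### the vorticity: class `C¹₂`, equation, far-field vanishing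
  obtain ⟨-, -, -, hω1, hωx⟩ := vorticity_c12_of_isDistributionalNSSolutionOn hIo isOpen_univ hsol hU4 hΦ
  obtain ⟨-, -, hineq⟩ := vorticity_carleman_inequality hIo isOpen_univ hsol hU4 hΦ hK₀ hK₁
  have hK₁0 : 0 ≤ K₁ := (norm_nonneg _).trans (hK₁ (t, 0) ⟨htI, mem_univ _⟩)
  have hK0sum : 0 ≤ K₀ + K₁ := add_nonneg ((norm_nonneg _).trans (hK₀ (t, 0) ⟨htI, mem_univ _⟩)) hK₁0
  have hωbd : ∀ z ∈ Ω, ‖(uncurry (vorticity V)) z‖ ≤ ‖curlCLM‖ * K₁ := fun z hz => by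
    show ‖vorticity V z.1 z.2‖ ≤ _
    rw [vorticity_apply]
    exact (norm_curl_le _ _).trans
      (mul_le_mul_of_nonneg_left (hK₁ z hz) (ContinuousLinearMap.opNorm_nonneg curlCLM))
  have hfarΩ : ∀ z ∈ I ×ˢ {y : EuclideanSpace ℝ (Fin 3) | ρ < ‖y‖}, vorticity V z.1 z.2 = 0 := by
    rintro z ⟨hz1, hz2⟩
    rw [vorticity_apply]
    exact hfar z ⟨hIsub hz1, hz2⟩
  -- ### unique continuation across the sphere `‖x‖ = ρ`, at the time `t`
  by_cases hxfar : ρ < ‖x‖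
  · exact hfar (t, x) ⟨⟨ht1, ht0⟩, hxfar⟩
  push Not at hxfar
  set e₀ : EuclideanSpace ℝ (Fin 3) := EuclideanSpace.basisFun (Fin 3) ℝ 0 with he₀
  have he₀n : ‖e₀‖ = 1 := (EuclideanSpace.basisFun (Fin 3) ℝ).orthonormal.1 0
  set x₁ : EuclideanSpace ℝ (Fin 3) := (ρ + 3) • e₀ with hx₁
  have hx₁n : ‖x₁‖ = ρ + 3 := by
    rw [hx₁, norm_smul, he₀n, mul_one, Real.norm_eq_abs, abs_of_pos (by linarith)]
  set Rb : ℝ := 2 * ρ + 10 with hRb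
  have hRbpos : 0 < Rb := by positivity
  set T' : ℝ := t + 1 with hT'
  have hT'pos : 0 < T' := by simp only [hT']; linarith
  set A : ℝ × EuclideanSpace ℝ (Fin 3) → ℝ × EuclideanSpace ℝ (Fin 3) := stAffine (-1) 1 t x₁ with hAdef
  have hA1 : ∀ z : ℝ × EuclideanSpace ℝ (Fin 3), (A z).1 = t - z.1 := fun z => by
    show t + (-1) * z.1 = t - z.1; ring
  have hA2 : ∀ z : ℝ × EuclideanSpace ℝ (Fin 3), (A z).2 = x₁ + z.2 := fun z => by
    show x₁ + (1 : ℝ) • z.2 = x₁ + z.2; rw [one_smul]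
  set Q' : Set (ℝ × EuclideanSpace ℝ (Fin 3)) := Ioo (0 : ℝ) T' ×ˢ ball (0 : EuclideanSpace ℝ (Fin 3)) Rb with hQ'
  have hAΩ' : ∀ z ∈ Ico (0 : ℝ) T' ×ˢ ball (0 : EuclideanSpace ℝ (Fin 3)) Rb, A z ∈ Ω := by
    rintro ⟨s, y⟩ ⟨hs, -⟩
    refine ⟨?_, mem_univ _⟩
    rw [hA1]
    have h1 := hs.1
    have h2 := hs.2
    simp only [hT'] at h2
    exact ⟨by simp only; linarith, by simp only; linarith⟩
  have hAΩ : ∀ z ∈ Q', A z ∈ Ω := fun z hz => hAΩ' z ⟨Ioo_subset_Ico_self hz.1, hz.2⟩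
  set ω : ℝ × EuclideanSpace ℝ (Fin 3) → EuclideanSpace ℝ (Fin 3) := uncurry (vorticity V) with hωdef
  set uu : ℝ × EuclideanSpace ℝ (Fin 3) → EuclideanSpace ℝ (Fin 3) := fun z => ω (A z) with hudef
  have hu1 : ContDiffOn ℝ 1 uu Q' :=
    (Carleman.contDiffOn_comp_stAffine hω1 (-1) 1 t x₁).mono fun z hz => hAΩ z hz
  have hdxu : ∀ e : EuclideanSpace ℝ (Fin 3), Carleman.dx e uu = fun z => Carleman.dx e ω (A z) := by
    intro e
    funext z
    rw [hudef, Carleman.dx_comp_stAffine (by norm_num) one_ne_zero ω e z, one_smul]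
  have hux : ∀ e : EuclideanSpace ℝ (Fin 3), ContDiffOn ℝ 1 (Carleman.dx e uu) Q' := by
    intro e
    rw [hdxu e]
    exact (Carleman.contDiffOn_comp_stAffine (hωx e) (-1) 1 t x₁).mono fun z hz => hAΩ z hz
  have hucont : ContinuousOn uu (Ico (0 : ℝ) T' ×ˢ ball (0 : EuclideanSpace ℝ (Fin 3)) Rb) :=
    (Carleman.continuousOn_comp_stAffine hω1.continuousOn (-1) 1 t x₁).mono fun z hz => hAΩ' z hz
  have hdtu : ∀ z, Carleman.dt uu z = (-1 : ℝ) • Carleman.dt ω (A z) := fun z => by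
    rw [hudef, Carleman.dt_comp_stAffine (by norm_num) one_ne_zero]
  have hlapu : ∀ z, Carleman.lap uu z = Carleman.lap ω (A z) := fun z => by
    rw [hudef, Carleman.lap_comp_stAffine (by norm_num) one_ne_zero, one_pow, one_smul]
  have hgradu : ∀ z, Carleman.gradSq uu z = Carleman.gradSq ω (A z) := fun z => by
    rw [hudef, Carleman.gradSq_comp_stAffine (by norm_num) one_ne_zero, one_pow, one_mul]
  have hinequ : ∀ z ∈ Q', ‖Carleman.dt uu z + Carleman.lap uu z‖ ≤
      (K₀ + K₁) * (‖uu z‖ + Real.sqrt (Carleman.gradSq uu z)) := by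
    intro z hz
    rw [hdtu z, hlapu z, hgradu z]
    have e1 : (-1 : ℝ) • Carleman.dt ω (A z) + Carleman.lap ω (A z) =
        -(Carleman.dt ω (A z) - Carleman.lap ω (A z)) := by
      rw [neg_one_smul]; abel
    rw [e1, norm_neg]
    exact hineq (A z) (hAΩ z hz)
  have hvan : ∀ k : ℕ, ∃ C : ℝ, ∀ z ∈ Q', ‖uu z‖ ≤ C * (‖z.2‖ + Real.sqrt z.1) ^ k := by
    intro k
    refine ⟨‖curlCLM‖ * K₁, fun z hz => ?_⟩
    have hbase : 0 ≤ ‖z.2‖ + Real.sqrt z.1 := by positivity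
    by_cases hy : ‖z.2‖ < 2
    · have hfar' : ρ < ‖x₁ + z.2‖ := by
        have h := norm_sub_le (x₁ + z.2) z.2
        rw [add_sub_cancel_right, hx₁n] at h
        linarith
      have h0 : uu z = 0 := by
        have h := hfarΩ (A z) ⟨(hAΩ z hz).1, by rw [hA2]; exact hfar'⟩
        show ω (A z) = 0
        exact h
      rw [h0, norm_zero]
      positivity
    · push Not at hy
      have h1 : (1 : ℝ) ≤ (‖z.2‖ + Real.sqrt z.1) ^ k :=
        one_le_pow₀ (by linarith [Real.sqrt_nonneg z.1])
      calc ‖uu z‖ = ‖ω (A z)‖ := rfl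
        _ ≤ ‖curlCLM‖ * K₁ := hωbd _ (hAΩ z hz)
        _ = ‖curlCLM‖ * K₁ * 1 := (mul_one _).symm
        _ ≤ ‖curlCLM‖ * K₁ * (‖z.2‖ + Real.sqrt z.1) ^ k :=
            mul_le_mul_of_nonneg_left h1 (mul_nonneg (ContinuousLinearMap.opNorm_nonneg _) hK₁0)
  have huc := Carleman.uniqueContinuation_uncurried_c12 3 3 (c₁ := K₀ + K₁) (R := Rb) (T := T')
    hK0sum hRbpos hT'pos hu1 hux hucont hinequ hvan
  have hy : x - x₁ ∈ ball (0 : EuclideanSpace ℝ (Fin 3)) Rb := by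
    rw [mem_ball_zero_iff]
    calc ‖x - x₁‖ ≤ ‖x‖ + ‖x₁‖ := norm_sub_le _ _
      _ < Rb := by rw [hx₁n, hRb]; linarith
  have h := huc (x - x₁) hy
  have hA0 : A (0, x - x₁) = (t, x) := by
    show (t + (-1) * (0 : ℝ), x₁ + (1 : ℝ) • (x - x₁)) = (t, x)
    simp
  have h' : ω (A (0, x - x₁)) = 0 := h
  rw [hA0] at h'
  have h'' : vorticity V t x = 0 := h'
  rwa [vorticity_apply] at h''


/-! ### Step C: the window `(-1, 0)`, then all of `(-∞, 0)` -/

/-- **Triviality on the last window.** A KNSS-gauge Type-I field with the space–time envelope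
whose slices have `∫_{ρ<‖x‖<r} ‖V(t)‖ → 0` at the top for every `r > ρ` (`ρ > 0`) vanishes on
`(-1, 0) × ℝ³`: by Steps A and B every slice `V(t)`, `-1 < t < 0`, is irrotational; it is
divergence free and bounded (Type I), hence constant (`eq_of_curl_eq_zero_of_isDivFree_of_bounded`,
harmonic Liouville), hence zero by the envelope. [cite: EscauriazaSereginSverak2003, §3 (after (3.32)) with Thms. 4.1 and 5.1] -/
theorem eq_zero_on_window {V : ℝ → EuclideanSpace ℝ (Fin 3) → EuclideanSpace ℝ (Fin 3)} {C₀ ρ : ℝ}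
    (hV : IsTypeIAncientMild C₀ V) (hdec : HasTypeIDecay C₀ V) (hρ : 0 < ρ)
    (htop : ∀ r : ℝ, ρ < r → Tendsto
      (fun t => ∫⁻ x in {x : EuclideanSpace ℝ (Fin 3) | ρ < ‖x‖ ∧ ‖x‖ < r}, ‖V t x‖ₑ) (𝓝[<] 0) (𝓝 0))
    {t : ℝ} (ht : t ∈ Ioo (-1 : ℝ) 0) (x : EuclideanSpace ℝ (Fin 3)) : V t x = 0 := by
  have hfar := farField_curl_eq_zero hV hdec hρ htop
  have hcurl : ∀ y, curl (V t) y = 0 := fun y => curl_eq_zero_of_farField hV hdec hρ hfar ht y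
  have hC2 : ContDiff ℝ 2 (V t) := (hV.contDiff_slice ht.2).of_le (by norm_cast)
  have hbd : ∀ y, ‖V t y‖ ≤ C₀ / Real.sqrt (-t) := fun y => hV.norm_le ht.2 y
  have hconst : ∀ y, V t y = V t 0 := fun y =>
    eq_of_curl_eq_zero_of_isDivFree_of_bounded hC2 hcurl (hV.isDivFree ht.2) hbd y 0
  have hb : V t 0 = 0 := const_eq_zero_of_hasTypeIDecay hdec ht.2 hconst
  rw [hconst x, hb]

/-- **Triviality on all of `(-∞, 0)`** by induction over past time-translates: if `V` vanishes on
`(-(1 + n/2), 0)`, the translate `t ↦ V(t - (1 + n)/2)` is again in the class with the same envelope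
(`IsTypeIAncientMild.comp_sub_right`, `hasTypeIDecay_comp_sub_right`) and vanishes identically near
the top, so `eq_zero_on_window` applies to it and `V` vanishes on `(-(1 + (n+1)/2), 0)`.
[cite: KochNadirashviliSereginSverak2009, §1 p. 3 (time translations; arXiv:0709.3599)] -/
theorem eq_zero_of_annulus_vanishing {V : ℝ → EuclideanSpace ℝ (Fin 3) → EuclideanSpace ℝ (Fin 3)}
    {C₀ ρ : ℝ} (hV : IsTypeIAncientMild C₀ V) (hdec : HasTypeIDecay C₀ V) (hρ : 0 < ρ)
    (htop : ∀ r : ℝ, ρ < r → Tendsto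
      (fun t => ∫⁻ x in {x : EuclideanSpace ℝ (Fin 3) | ρ < ‖x‖ ∧ ‖x‖ < r}, ‖V t x‖ₑ) (𝓝[<] 0) (𝓝 0)) :
    ∀ t < 0, ∀ x, V t x = 0 := by
  have hC₀ : 0 ≤ C₀ := hV.nonneg
  -- `P n`: `V = 0` on `(-(1 + n/2), 0)`
  have hP : ∀ n : ℕ, ∀ t : ℝ, -(1 + (n : ℝ) / 2) < t → t < 0 → ∀ x, V t x = 0 := by
    intro n
    induction n with
    | zero =>
      intro t ht1 ht0 x
      exact eq_zero_on_window hV hdec hρ htop ⟨by simpa using ht1, ht0⟩ x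
    | succ n ih =>
      intro t ht1 ht0 x
      by_cases hlate : -(1 + (n : ℝ) / 2) < t
      · exact ih t hlate ht0 x
      push Not at hlate
      -- the translate by `δ = (1 + n)/2`
      set δ : ℝ := (1 + (n : ℝ)) / 2 with hδdef
      have hδ0 : 0 ≤ δ := by positivity
      set W : ℝ → EuclideanSpace ℝ (Fin 3) → EuclideanSpace ℝ (Fin 3) := fun s => V (s - δ) with hWdef
      have hW : IsTypeIAncientMild C₀ W := hV.comp_sub_right hδ0
      have hWdec : HasTypeIDecay C₀ W := hasTypeIDecay_comp_sub_right hC₀ hdec hδ0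
      -- `W` vanishes identically for `-1/2 < s < 0`, so the annulus hypothesis holds trivially
      have hWtop : ∀ r : ℝ, ρ < r → Tendsto
          (fun s => ∫⁻ x in {x : EuclideanSpace ℝ (Fin 3) | ρ < ‖x‖ ∧ ‖x‖ < r}, ‖W s x‖ₑ)
          (𝓝[<] 0) (𝓝 0) := by
        intro r _
        have hev : ∀ᶠ s in 𝓝[<] (0 : ℝ),
            (∫⁻ x in {x : EuclideanSpace ℝ (Fin 3) | ρ < ‖x‖ ∧ ‖x‖ < r}, ‖W s x‖ₑ) = 0 := by
          have hmem : Ioo (-(1 / 2 : ℝ)) 0 ∈ 𝓝[<] (0 : ℝ) := Ioo_mem_nhdsLT (by norm_num)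
          filter_upwards [hmem] with s hs
          have hzero : ∀ x, W s x = 0 := fun x => by
            show V (s - δ) x = 0
            refine ih (s - δ) ?_ (by rw [hδdef]; linarith [hs.2]) x
            rw [hδdef]; linarith [hs.1]
          simp [hzero]
        exact tendsto_const_nhds.congr' (hev.mono fun s hs => hs.symm)
      have hwin := eq_zero_on_window hW hWdec hρ hWtop (t := t + δ)
        ⟨by rw [hδdef]; push_cast at ht1 ⊢; linarith, by rw [hδdef]; linarith⟩ x
      simpa [hWdef] using hwin
  intro t ht x
  obtain ⟨n, hn⟩ := exists_nat_gt (2 * (-t))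
  exact hP n t (by linarith) ht x

/-! ### The item -/

/-- **Item stmt-NavierStokesRegularity-1104 `QuarterTurnRdss.NoSilentTypeIProfile` — every Type-I
ancient mild solution leaves debris.** An ancient mild solution `u` of the Navier–Stokes equations
(`ν = 1`, duality form) on `ℝ³ × (−∞, 0)` with measurable slices and the Type-I bound
`‖u(t,x)‖ ≤ C₀/(‖x‖ + √(−t))`, whose slices satisfy `∫_{ρ<‖x‖<r} ‖u(t,x)‖ dx → 0` as `t → 0⁻` for
every `r > ρ`, has `u(t) = 0` a.e. for every `t < 0`. Proof: pass to the smooth KNSS-gauge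
representative (`typeI_ancient_smoothRepresentative_ae`), enlarge `ρ` to `max ρ 1 > 0`, and apply
`eq_zero_of_annulus_vanishing` (ESS 2003 backward uniqueness across half-spaces + unique continuation
+ harmonic Liouville, iterated over past windows). [cite: EscauriazaSereginSverak2003, §3 and Thms. 4.1, 5.1] -/
theorem quarterTurnRdss_noSilentTypeIProfile_proof :
    Summit.NavierStokesRegularity.NavierStokesRegularity.Theses.QuarterTurnRdss.NoSilentTypeIProfile := by
  intro u hmild hmeas hC hρ
  obtain ⟨C₀, hC₀⟩ := hC
  obtain ⟨ρ, hρ⟩ := hρ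
  obtain ⟨V, hV, hdec, hVu, -⟩ := typeI_ancient_smoothRepresentative_ae hmild hmeas hC₀
  set ρ₁ : ℝ := max ρ 1 with hρ₁def
  have hρ₁ : 0 < ρ₁ := lt_of_lt_of_le one_pos (le_max_right _ _)
  -- the annulus hypothesis for `V` and `ρ₁`
  have htopV : ∀ r : ℝ, ρ₁ < r → Tendsto
      (fun t => ∫⁻ x in {x : EuclideanSpace ℝ (Fin 3) | ρ₁ < ‖x‖ ∧ ‖x‖ < r}, ‖V t x‖ₑ)
      (𝓝[<] 0) (𝓝 0) := by
    intro r hr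
    have hρr : ρ < r := lt_of_le_of_lt (le_max_left _ _) hr
    have hsub : {x : EuclideanSpace ℝ (Fin 3) | ρ₁ < ‖x‖ ∧ ‖x‖ < r} ⊆
        {x : EuclideanSpace ℝ (Fin 3) | ρ < ‖x‖ ∧ ‖x‖ < r} :=
      fun x hx => ⟨lt_of_le_of_lt (le_max_left _ _) hx.1, hx.2⟩
    refine tendsto_of_tendsto_of_tendsto_of_le_of_le' tendsto_const_nhds (hρ r hρr)
      (Eventually.of_forall fun t => zero_le) ?_
    have hmem : Iio (0 : ℝ) ∈ 𝓝[<] (0 : ℝ) := self_mem_nhdsWithin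
    filter_upwards [hmem] with t ht
    have ht' : t < 0 := ht
    calc (∫⁻ x in {x : EuclideanSpace ℝ (Fin 3) | ρ₁ < ‖x‖ ∧ ‖x‖ < r}, ‖V t x‖ₑ)
        = ∫⁻ x in {x : EuclideanSpace ℝ (Fin 3) | ρ₁ < ‖x‖ ∧ ‖x‖ < r}, ‖u t x‖ₑ :=
          lintegral_congr_ae ((ae_restrict_of_ae (hVu t ht')).mono fun x hx => by
            show ‖V t x‖ₑ = ‖u t x‖ₑ
            rw [hx])
      _ ≤ ∫⁻ x in {x : EuclideanSpace ℝ (Fin 3) | ρ < ‖x‖ ∧ ‖x‖ < r}, ‖u t x‖ₑ :=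
          lintegral_mono_set hsub
  have hzero := eq_zero_of_annulus_vanishing hV hdec hρ₁ htopV
  intro t ht
  have hVt : V t = 0 := funext fun x => hzero t ht x
  exact (hVu t ht).symm.trans (Eventually.of_forall fun x => by rw [hVt])

end Summit.NavierStokesRegularity.NavierStokesRegularity.Theorems.NoSilentTypeIProfile

end
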